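import Literature.Algebra.Polynomial.CasasAlvero.Char127Digits
import Literature.Algebra.Polynomial.CasasAlvero.Degree7Char127
import Literature.Algebra.Polynomial.CasasAlvero.Degree6CandidatesPrime
import Literature.Algebra.Polynomial.CasasAlvero.Degree5
import Literature.Algebra.Polynomial.CasasAlvero.Degree6
import Literature.Algebra.Polynomial.CasasAlvero.DigitReduction
import HarnessLib

/-!
# Casas-Alvero degrees in characteristic 127: the complete classification

Over EVERY field `K` of characteristic `127`: `CA_d(K) ⟺ d = 0 ∨ d = a·127^k` with `1 ≤ a ≤ 7` — the first prime characteristic with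
SEVEN good digits ([CastryckLaterveerOunaies2012, Thm. 4]: `127` is the smallest good prime for degree `7`, and it is good for every degree `≤ 6`).
Ingredients: the digit reduction `CA_d ⇒ d = a·p^k ∧ CA_a` (`DigitReduction.lean`, any field); the positive digits `1, 2, 3, 4`
([GrafVonBothmerEtAl2007, Props. 2, 6]), `5` (`Degree5.lean`), `6` (`127` is not among the `54` candidate bad primes of degree `6` of
`Degree6CandidatesPrime.lean`, so `CA_6` holds in characteristic `127` [CastryckLaterveerOunaies2012, Thm. 4]) and `7` (`Degree7Char127.lean`:
the kernel-checked case analysis `holdsInDegree_seven_of_char_127`, [CastryckLaterveerOunaies2012, Thm. 4] for `d = 7`, with `CA_{7·127^k}` descending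
from the algebraic closure); and a refutation of every digit `8 ≤ a ≤ 126` over every field of characteristic `127`:
`33, 34, 48, 51, 72, 73, 77, 79, 81, 85, 91, 93, 97, 98, 99, 102, 104, 105, 108, 110, 121, 122, 124, 126` by the binomial criterion
(`m = 6, 16, 24, 16, 7, 35, 30, 30, 40, 40, 16, 21, 5, 29, 6, 24, 47, 33, 16, 18, 29, 5, 21, 2`); and the 95 remaining digits by the sparse `𝔽_127`-examples of `Char127Digits.lean`
(whose module docstring called the resulting classification "complete conditionally on `CA_7` in characteristic `127`" — that condition is now a theorem).
-/

noncomputable section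

open Polynomial

set_option maxRecDepth 8192

namespace Literature.Algebra.Polynomial.CasasAlvero

section CharOneHundredTwentySeven

variable (K : Type*) [Field K] [CharP K 127]

/-- `CA_{6·127^k}` over every field of characteristic `127` (`CA_6` itself — the case `k = 0` — holds because `127` is not among the
`54` candidate bad primes of degree `6` of `Degree6CandidatesPrime.lean`, `holdsInDegree_six_of_not_mem`, i.e. `127` is a GOOD prime for degree `6`
[cite: CastryckLaterveerOunaies2012, Thm. 4]). [cite: GrafVonBothmerEtAl2007, Prop. 6] -/
theorem holdsInDegree_six_mul_pow_of_char_127' (k : ℕ) : HoldsInDegree K (6 * 127 ^ k) := by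
  haveI : Fact (Nat.Prime 127) := ⟨by norm_num⟩
  exact holdsInDegree_mul_prime_pow_field K 127 (holdsInDegree_six_of_not_mem (K := AlgebraicClosure K) 127 (by decide)) k

/-- every digit `8 ≤ a < 127` fails: `¬ CA_a` over every field of characteristic `127` — the bad-prime computations of
[cite: CastryckLaterveerOunaies2012, Thm. 4] (degrees `≤ 7`) extended to every digit `8 ≤ a < 127` by explicit `𝔽_127`-rational examples and the
binomial criterion. [cite: GrafVonBothmerEtAl2007, Prop. 6] -/
theorem not_holdsInDegree_digit_of_char_oneHundredTwentySeven {a : ℕ} (h8 : 8 ≤ a) (hap : a < 127) : ¬ HoldsInDegree K a := by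
  haveI : Fact (Nat.Prime 127) := ⟨by norm_num⟩
  interval_cases a
  · exact not_holdsInDegree_eight_of_char_127 K
  · exact not_holdsInDegree_nine_of_char_127 K
  · exact not_holdsInDegree_ten_of_char_127 K
  · exact not_holdsInDegree_eleven_of_char_127 K
  · exact not_holdsInDegree_twelve_of_char_127 K
  · exact not_holdsInDegree_thirteen_of_char_127 K
  · exact not_holdsInDegree_fourteen_of_char_127 K
  · exact not_holdsInDegree_fifteen_of_char_127 K
  · exact not_holdsInDegree_sixteen_of_char_127 K
  · exact not_holdsInDegree_seventeen_of_char_127 K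
  · exact not_holdsInDegree_eighteen_of_char_127 K
  · exact not_holdsInDegree_nineteen_of_char_127 K
  · exact not_holdsInDegree_twenty_of_char_127 K
  · exact not_holdsInDegree_twentyOne_of_char_127 K
  · exact not_holdsInDegree_twentyTwo_of_char_127 K
  · exact not_holdsInDegree_twentyThree_of_char_127 K
  · exact not_holdsInDegree_twentyFour_of_char_127 K
  · exact not_holdsInDegree_twentyFive_of_char_127 K
  · exact not_holdsInDegree_twentySix_of_char_127 K
  · exact not_holdsInDegree_twentySeven_of_char_127 K
  · exact not_holdsInDegree_twentyEight_of_char_127 K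
  · exact not_holdsInDegree_twentyNine_of_char_127 K
  · exact not_holdsInDegree_thirty_of_char_127 K
  · exact not_holdsInDegree_thirtyOne_of_char_127 K
  · exact not_holdsInDegree_thirtyTwo_of_char_127 K
  · exact not_holdsInDegree_of_choose_modEq_one K 127 (d := 33) (m := 6) (by norm_num) (by norm_num) (by decide)
  · exact not_holdsInDegree_of_choose_modEq_one K 127 (d := 34) (m := 16) (by norm_num) (by norm_num) (by decide)
  · exact not_holdsInDegree_thirtyFive_of_char_127 K
  · exact not_holdsInDegree_thirtySix_of_char_127 K
  · exact not_holdsInDegree_thirtySeven_of_char_127 K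
  · exact not_holdsInDegree_thirtyEight_of_char_127 K
  · exact not_holdsInDegree_thirtyNine_of_char_127 K
  · exact not_holdsInDegree_forty_of_char_127 K
  · exact not_holdsInDegree_fortyOne_of_char_127 K
  · exact not_holdsInDegree_fortyTwo_of_char_127 K
  · exact not_holdsInDegree_fortyThree_of_char_127 K
  · exact not_holdsInDegree_fortyFour_of_char_127 K
  · exact not_holdsInDegree_fortyFive_of_char_127 K
  · exact not_holdsInDegree_fortySix_of_char_127 K
  · exact not_holdsInDegree_fortySeven_of_char_127 K
  · exact not_holdsInDegree_of_choose_modEq_one K 127 (d := 48) (m := 24) (by norm_num) (by norm_num) (by decide)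
  · exact not_holdsInDegree_fortyNine_of_char_127 K
  · exact not_holdsInDegree_fifty_of_char_127 K
  · exact not_holdsInDegree_of_choose_modEq_one K 127 (d := 51) (m := 16) (by norm_num) (by norm_num) (by decide)
  · exact not_holdsInDegree_fiftyTwo_of_char_127 K
  · exact not_holdsInDegree_fiftyThree_of_char_127 K
  · exact not_holdsInDegree_fiftyFour_of_char_127 K
  · exact not_holdsInDegree_fiftyFive_of_char_127 K
  · exact not_holdsInDegree_fiftySix_of_char_127 K
  · exact not_holdsInDegree_fiftySeven_of_char_127 K
  · exact not_holdsInDegree_fiftyEight_of_char_127 K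
  · exact not_holdsInDegree_fiftyNine_of_char_127 K
  · exact not_holdsInDegree_sixty_of_char_127 K
  · exact not_holdsInDegree_sixtyOne_of_char_127 K
  · exact not_holdsInDegree_sixtyTwo_of_char_127 K
  · exact not_holdsInDegree_sixtyThree_of_char_127 K
  · exact not_holdsInDegree_sixtyFour_of_char_127 K
  · exact not_holdsInDegree_sixtyFive_of_char_127 K
  · exact not_holdsInDegree_sixtySix_of_char_127 K
  · exact not_holdsInDegree_sixtySeven_of_char_127 K
  · exact not_holdsInDegree_sixtyEight_of_char_127 K
  · exact not_holdsInDegree_sixtyNine_of_char_127 K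
  · exact not_holdsInDegree_seventy_of_char_127 K
  · exact not_holdsInDegree_seventyOne_of_char_127 K
  · exact not_holdsInDegree_of_choose_modEq_one K 127 (d := 72) (m := 7) (by norm_num) (by norm_num) (by decide)
  · exact not_holdsInDegree_of_choose_modEq_one K 127 (d := 73) (m := 35) (by norm_num) (by norm_num) (by decide)
  · exact not_holdsInDegree_seventyFour_of_char_127 K
  · exact not_holdsInDegree_seventyFive_of_char_127 K
  · exact not_holdsInDegree_seventySix_of_char_127 K
  · exact not_holdsInDegree_of_choose_modEq_one K 127 (d := 77) (m := 30) (by norm_num) (by norm_num) (by decide)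
  · exact not_holdsInDegree_seventyEight_of_char_127 K
  · exact not_holdsInDegree_of_choose_modEq_one K 127 (d := 79) (m := 30) (by norm_num) (by norm_num) (by decide)
  · exact not_holdsInDegree_eighty_of_char_127 K
  · exact not_holdsInDegree_of_choose_modEq_one K 127 (d := 81) (m := 40) (by norm_num) (by norm_num) (by decide)
  · exact not_holdsInDegree_eightyTwo_of_char_127 K
  · exact not_holdsInDegree_eightyThree_of_char_127 K
  · exact not_holdsInDegree_eightyFour_of_char_127 K
  · exact not_holdsInDegree_of_choose_modEq_one K 127 (d := 85) (m := 40) (by norm_num) (by norm_num) (by decide)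
  · exact not_holdsInDegree_eightySix_of_char_127 K
  · exact not_holdsInDegree_eightySeven_of_char_127 K
  · exact not_holdsInDegree_eightyEight_of_char_127 K
  · exact not_holdsInDegree_eightyNine_of_char_127 K
  · exact not_holdsInDegree_ninety_of_char_127 K
  · exact not_holdsInDegree_of_choose_modEq_one K 127 (d := 91) (m := 16) (by norm_num) (by norm_num) (by decide)
  · exact not_holdsInDegree_ninetyTwo_of_char_127 K
  · exact not_holdsInDegree_of_choose_modEq_one K 127 (d := 93) (m := 21) (by norm_num) (by norm_num) (by decide)
  · exact not_holdsInDegree_ninetyFour_of_char_127 K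
  · exact not_holdsInDegree_ninetyFive_of_char_127 K
  · exact not_holdsInDegree_ninetySix_of_char_127 K
  · exact not_holdsInDegree_of_choose_modEq_one K 127 (d := 97) (m := 5) (by norm_num) (by norm_num) (by decide)
  · exact not_holdsInDegree_of_choose_modEq_one K 127 (d := 98) (m := 29) (by norm_num) (by norm_num) (by decide)
  · exact not_holdsInDegree_of_choose_modEq_one K 127 (d := 99) (m := 6) (by norm_num) (by norm_num) (by decide)
  · exact not_holdsInDegree_oneHundred_of_char_127 K
  · exact not_holdsInDegree_oneHundredOne_of_char_127 K
  · exact not_holdsInDegree_of_choose_modEq_one K 127 (d := 102) (m := 24) (by norm_num) (by norm_num) (by decide)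
  · exact not_holdsInDegree_oneHundredThree_of_char_127 K
  · exact not_holdsInDegree_of_choose_modEq_one K 127 (d := 104) (m := 47) (by norm_num) (by norm_num) (by decide)
  · exact not_holdsInDegree_of_choose_modEq_one K 127 (d := 105) (m := 33) (by norm_num) (by norm_num) (by decide)
  · exact not_holdsInDegree_oneHundredSix_of_char_127 K
  · exact not_holdsInDegree_oneHundredSeven_of_char_127 K
  · exact not_holdsInDegree_of_choose_modEq_one K 127 (d := 108) (m := 16) (by norm_num) (by norm_num) (by decide)
  · exact not_holdsInDegree_oneHundredNine_of_char_127 K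
  · exact not_holdsInDegree_of_choose_modEq_one K 127 (d := 110) (m := 18) (by norm_num) (by norm_num) (by decide)
  · exact not_holdsInDegree_oneHundredEleven_of_char_127 K
  · exact not_holdsInDegree_oneHundredTwelve_of_char_127 K
  · exact not_holdsInDegree_oneHundredThirteen_of_char_127 K
  · exact not_holdsInDegree_oneHundredFourteen_of_char_127 K
  · exact not_holdsInDegree_oneHundredFifteen_of_char_127 K
  · exact not_holdsInDegree_oneHundredSixteen_of_char_127 K
  · exact not_holdsInDegree_oneHundredSeventeen_of_char_127 K
  · exact not_holdsInDegree_oneHundredEighteen_of_char_127 K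
  · exact not_holdsInDegree_oneHundredNineteen_of_char_127 K
  · exact not_holdsInDegree_oneHundredTwenty_of_char_127 K
  · exact not_holdsInDegree_of_choose_modEq_one K 127 (d := 121) (m := 29) (by norm_num) (by norm_num) (by decide)
  · exact not_holdsInDegree_of_choose_modEq_one K 127 (d := 122) (m := 5) (by norm_num) (by norm_num) (by decide)
  · exact not_holdsInDegree_oneHundredTwentyThree_of_char_127 K
  · exact not_holdsInDegree_of_choose_modEq_one K 127 (d := 124) (m := 21) (by norm_num) (by norm_num) (by decide)
  · exact not_holdsInDegree_oneHundredTwentyFive_of_char_127 K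
  · exact not_holdsInDegree_of_choose_modEq_one K 127 (d := 126) (m := 2) (by norm_num) (by norm_num) (by decide)

/-- the positive digits `1 ≤ a ≤ 5`: `CA_{a·127^k}` over every field of characteristic `127`. [cite: GrafVonBothmerEtAl2007, Props. 2, 6]
[cite: CastryckLaterveerOunaies2012, Thm. 4] -/
theorem holdsInDegree_mul_oneHundredTwentySeven_pow_of_le_five {a : ℕ} (ha0 : 0 < a) (ha5 : a ≤ 5) (k : ℕ) :
    HoldsInDegree K (a * 127 ^ k) := by
  haveI : Fact (Nat.Prime 127) := ⟨by norm_num⟩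
  interval_cases a
  · simpa using holdsInDegree_prime_pow_field K 127 k
  · exact holdsInDegree_two_mul_prime_pow_field K 127 k
  · exact holdsInDegree_three_mul_prime_pow_field K 127 (by norm_num) k
  · exact holdsInDegree_mul_prime_pow_field K 127
      (holdsInDegree_of_le_four_of_charP (AlgebraicClosure K) 127 (by norm_num) le_rfl) k
  · exact holdsInDegree_five_mul_prime_pow_field K 127 (by norm_num) (by norm_num) (by norm_num) (by norm_num)
      (by norm_num) (by norm_num) (by norm_num) (by norm_num) (by norm_num) k

/-- **characteristic 127, complete**: over every field of characteristic `127`,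
`CA_d ⟺ d = 0 ∨ d = a·127^k` with `1 ≤ a ≤ 7`. [cite: GrafVonBothmerEtAl2007, Props. 2, 6, 7]
[cite: CastryckLaterveerOunaies2012, Thm. 4] -/
theorem classification_char_oneHundredTwentySeven_complete (d : ℕ) :
    HoldsInDegree K d ↔ d = 0 ∨ ∃ k a : ℕ, 0 < a ∧ a ≤ 7 ∧ d = a * 127 ^ k := by
  haveI : Fact (Nat.Prime 127) := ⟨by norm_num⟩
  constructor
  · intro h
    rcases Nat.eq_zero_or_pos d with rfl | hd
    · exact Or.inl rfl
    obtain ⟨k, a, ha0, hap, rfl, ha⟩ := digit_of_holdsInDegree K 127 hd.ne' h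
    refine Or.inr ⟨k, a, ha0, ?_, rfl⟩
    by_contra h7
    exact not_holdsInDegree_digit_of_char_oneHundredTwentySeven K (by omega) hap ha
  · rintro (rfl | ⟨k, a, ha0, ha7, rfl⟩)
    · exact holdsInDegree_zero K
    · rcases Nat.lt_or_ge a 6 with ha | ha
      · exact holdsInDegree_mul_oneHundredTwentySeven_pow_of_le_five K ha0 (by omega) k
      · rcases Nat.lt_or_ge a 7 with ha' | ha'
        · obtain rfl : a = 6 := by omega
          exact holdsInDegree_six_mul_pow_of_char_127' K k
        · obtain rfl : a = 7 := le_antisymm ha7 ha'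
          exact holdsInDegree_seven_mul_pow_of_char_127 (K := K) k

/-- the set of Casas-Alvero degrees `≤ 16129` in characteristic `127`, explicitly (corollary of the classification:
[cite: GrafVonBothmerEtAl2007, Prop. 6] with [cite: CastryckLaterveerOunaies2012, Thm. 4] and the digit refutations above). -/
theorem holdsInDegree_iff_mem_of_le_char_oneHundredTwentySeven_sq {d : ℕ} (hd : d ≤ 16129) :
    HoldsInDegree K d ↔ d ∈ ({0, 1, 2, 3, 4, 5, 6, 7, 127, 254, 381, 508, 635, 762, 889, 16129} : Finset ℕ) := by
  rw [classification_char_oneHundredTwentySeven_complete]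
  constructor
  · rintro (rfl | ⟨k, a, ha0, ha7, rfl⟩)
    · decide
    · rcases k with _ | _ | _ | k
      · interval_cases a <;> decide
      · interval_cases a <;> decide
      · interval_cases a <;> simp_all
      · exfalso
        have : 127 ^ 3 ≤ a * 127 ^ (k + 1 + 1 + 1) :=
          le_trans (Nat.pow_le_pow_right (by norm_num) (by omega)) (Nat.le_mul_of_pos_left _ ha0)
        omega
  · intro h
    simp only [Finset.mem_insert, Finset.mem_singleton] at h
    rcases h with rfl | rfl | rfl | rfl | rfl | rfl | rfl | rfl | rfl | rfl | rfl | rfl | rfl | rfl | rfl | rfl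
    · exact Or.inl rfl
    · exact Or.inr ⟨0, 1, by norm_num, by norm_num, by norm_num⟩
    · exact Or.inr ⟨0, 2, by norm_num, by norm_num, by norm_num⟩
    · exact Or.inr ⟨0, 3, by norm_num, by norm_num, by norm_num⟩
    · exact Or.inr ⟨0, 4, by norm_num, by norm_num, by norm_num⟩
    · exact Or.inr ⟨0, 5, by norm_num, by norm_num, by norm_num⟩
    · exact Or.inr ⟨0, 6, by norm_num, by norm_num, by norm_num⟩
    · exact Or.inr ⟨0, 7, by norm_num, by norm_num, by norm_num⟩
    · exact Or.inr ⟨1, 1, by norm_num, by norm_num, by norm_num⟩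
    · exact Or.inr ⟨1, 2, by norm_num, by norm_num, by norm_num⟩
    · exact Or.inr ⟨1, 3, by norm_num, by norm_num, by norm_num⟩
    · exact Or.inr ⟨1, 4, by norm_num, by norm_num, by norm_num⟩
    · exact Or.inr ⟨1, 5, by norm_num, by norm_num, by norm_num⟩
    · exact Or.inr ⟨1, 6, by norm_num, by norm_num, by norm_num⟩
    · exact Or.inr ⟨1, 7, by norm_num, by norm_num, by norm_num⟩
    · exact Or.inr ⟨2, 1, by norm_num, by norm_num, by norm_num⟩

end CharOneHundredTwentySeven

end Literature.Algebra.Polynomial.CasasAlvero
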